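import Summits.HodgeConjecture.CorCM.WeilLineMonomials
import Summits.HodgeConjecture.CorCM.WeilLineDiagonal
import Literature.AlgebraicGeometry.HodgeTheory.LefschetzOneOneHolds
import Literature.NumberTheory.ComplexMultiplication.CMTypeBasic
import Mathlib.RingTheory.DedekindDomain.IntegralClosure
import HarnessLib

/-!
# COR-CM (cell `pub-hodgecm2`): the monomials of a CONJUGATE PAIR of CM-typed realisations are algebraic
# (Lefschetz `(1,1)` on `B 0 ⊞ B 1`)

HONEST FRAMING (cell pub-hodgecm2 / COR-CM, binder prover p2; count-neutral layer L0 (P) of lit-andre-3's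
sized ask A1, first half): a `(1,1)`-statement — the only input is the Lefschetz theorem on `(1,1)`-classes,
a THEOREM of the tree (`HodgeTheory.lefschetzOneOne_rational_holds`); no period theorem, no Markman.

Setting: a number field `K`, a pair of slots `B 0`, `B 1` with `𝓞_K`-actions `act m` realising CM types
`Ψ 0`, `Ψ 1 = Ψ̄ 0` (`CMTypeOps.bar`) — a CONJUGATE PAIR — and eigenbases `v m` of `H¹`.  Then every monomial
`μ_σ = π_0^* v_{0,σ} ⌣ π_1^* v_{1,σ} ∈ H²((B 0 ⊞ B 1)(ℂ); ℂ)` (`WeilLineMonomial.monomial`, `d = 2`) is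
ALGEBRAIC (`pairMonomial_mem_algebraicClasses`).  Proof: for integral families `b, e ⊂ 𝓞_K` dual for the
trace form up to an integer `N ≠ 0` (`exists_integral_dual_family`: an integral basis and a multiple of its
trace dual, `CorCM.Model.sum_embedding_mul_embedding_dual`) the bilinear PAIRING OPERATOR
`R(x, y) = Σ_i π_0^*(b_i^* x) ⌣ π_1^*(e_i^* y)` (`pairForm`) satisfies `R(v_{0,σ}, v_{1,σ}) = N μ_σ` and
`R(v_{0,σ}, v_{1,τ}) = 0` for `σ ≠ τ`, so all its values lie in `⊕_σ ℂ μ_σ`, which consists of `(1,1)`-classes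
(exactly one of `v_{0,σ}`, `v_{1,σ}` is holomorphic); its values on RATIONAL classes are rational, hence
algebraic (Lefschetz); rational classes span `H¹` over `ℂ` (`exists_basis_isRationalClass`), so every value
is algebraic, in particular `N μ_σ`.  Companion: `CorCM/WeilLinePairsAlgebraic.lean` (two pairs, four slots).

References: [Deligne1982HodgeCycles] LNM 900 (1982), §4 (4.4); [MoonenZarhin1998WeilClasses] J. reine angew.
Math. 496 (1998), §1; [VoisinHodgeI2002] Thm. 11.30 (Lefschetz theorem on `(1,1)`-classes).
-/

noncomputable section

namespace Summit.HodgeConjecture.CorCM.WeilLineMonomial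

open CategoryTheory CategoryTheory.Limits NumberField MonoidalCategory
open Literature.AlgebraicTopology.SingularHomology
open Literature.AlgebraicGeometry Literature.AlgebraicGeometry.Motives Literature.AlgebraicGeometry.HodgeTheory
open Literature.AlgebraicGeometry.ComplexMultiplication
open Literature.NumberTheory.ComplexMultiplication (CMTypeOps.bar CMTypeOps.mem_bar_iff)
open Literature.NumberTheory.Automorphic.PicardCM (eigenline)
open Summit.HodgeConjecture.CorCM.AndreProductForm
open Summit.HodgeConjecture.HodgeConjecture.Theorems.HodgeAbelianVarieties.CMPivotAndre
  (complexBetti_map_map_one_apply)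

variable {K : Type} [Field K] [NumberField K]

/-! ## An integral family dual for the trace form up to an integer -/

/-- **Integral dual families.** There are finite families `b, e` of algebraic INTEGERS of `K` and an
integer `N ≠ 0` with `Σ_i σ(b_i) σ(e_i) = N` and `Σ_i σ(b_i) τ(e_i) = 0` for all complex embeddings `σ ≠ τ`
(an integral basis and an integral multiple of its trace-dual basis; the separability idempotent of `K/ℚ`
in coordinates, `CorCM.Model.sum_embedding_mul_embedding_dual`). [folklore] -/
theorem exists_integral_dual_family (K : Type) [Field K] [NumberField K] :
    ∃ (ι : Type) (_ : Fintype ι) (b e : ι → 𝓞 K) (N : ℤ), N ≠ 0 ∧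
      (∀ σ : K →+* ℂ, ∑ i, σ (b i : K) * σ (e i : K) = (N : ℂ)) ∧
      ∀ σ τ : K →+* ℂ, σ ≠ τ → ∑ i, σ (b i : K) * τ (e i : K) = 0 := by
  classical
  -- an integral `ℚ`-basis, its trace dual and a common denominator
  let d := (Algebra.traceForm ℚ K).dualBasis (traceForm_nondegenerate ℚ K) (integralBasis K)
  obtain ⟨N, hN, hint⟩ := exists_integral_multiples ℤ ℚ (Finset.univ.image d)
  have hmem : ∀ i, IsIntegral ℤ (N • d i) := fun i => hint _ (Finset.mem_image_of_mem d (Finset.mem_univ i))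
  have key : ∀ σ τ : K →+* ℂ, ∑ i, σ ((RingOfIntegers.basis K i : 𝓞 K) : K) *
      τ (((⟨N • d i, (mem_integralClosure_iff ℤ K).2 (hmem i)⟩ : 𝓞 K) : K)) =
        (N : ℂ) * if σ = τ then 1 else 0 := by
    intro σ τ
    rw [← Summit.HodgeConjecture.CorCM.Model.sum_embedding_mul_embedding_dual (integralBasis K) σ τ,
      Finset.mul_sum]
    refine Finset.sum_congr rfl fun i _ => ?_
    rw [integralBasis_apply, RingOfIntegers.coe_mk, map_zsmul τ, zsmul_eq_mul]
    ring
  refine ⟨_, inferInstance, fun i => RingOfIntegers.basis K i,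
    fun i => ⟨N • d i, (mem_integralClosure_iff ℤ K).2 (hmem i)⟩, N, hN, fun σ => ?_, fun σ τ hστ => ?_⟩
  · simpa using key σ σ
  · simpa [if_neg hστ] using key σ τ

/-! ## One conjugate pair: the monomials are algebraic -/

section Pair

variable {B : Fin 2 → AbelianVariety ℂ} {act : ∀ m, 𝓞 K →+* End (B m)}
  {θ : ∀ m, K →+* Module.End ℂ (complexBetti (B m).X 1)} {Ψ : Fin 2 → CMType K}
  {v : ∀ m, Module.Basis (K →+* ℂ) ℂ (complexBetti (B m).X 1)}

/-- The **pairing operator** `R(x, y) = Σ_i π_0^*(b_i^* x) ⌣ π_1^*(e_i^* y)` on `H¹(B 0) × H¹(B 1)` with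
values in `H²(B 0 ⊞ B 1)`, for integral families `b, e` (bilinear over `ℂ`). [cite: Deligne1982HodgeCycles, §4 (4.4)] -/
def pairForm (B : Fin 2 → AbelianVariety ℂ) (act : ∀ m, 𝓞 K →+* End (B m)) {ι : Type} [Fintype ι]
    (b e : ι → 𝓞 K) :
    complexBetti (B 0).X 1 →ₗ[ℂ] complexBetti (B 1).X 1 →ₗ[ℂ] complexBetti (⨁ B).X 2 :=
  ∑ i, (cupProduct (Nat.add_comm 1 1)).compl₁₂
    ((complexBetti.map (biproduct.π B 0).hom.hom.hom 1).hom ∘ₗ (complexBetti.map (act 0 (b i)).hom.hom.hom 1).hom)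
    ((complexBetti.map (biproduct.π B 1).hom.hom.hom 1).hom ∘ₗ (complexBetti.map (act 1 (e i)).hom.hom.hom 1).hom)

omit [NumberField K] in
/-- Unfolding of `pairForm`. [folklore] -/
theorem pairForm_apply {ι : Type} [Fintype ι] (b e : ι → 𝓞 K) (x : complexBetti (B 0).X 1)
    (y : complexBetti (B 1).X 1) :
    pairForm B act b e x y = ∑ i, cupProduct (Nat.add_comm 1 1)
      (complexBetti.map (biproduct.π B 0).hom.hom.hom 1 (complexBetti.map (act 0 (b i)).hom.hom.hom 1 x))
      (complexBetti.map (biproduct.π B 1).hom.hom.hom 1 (complexBetti.map (act 1 (e i)).hom.hom.hom 1 y)) := by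
  simp only [pairForm, LinearMap.coe_sum, Finset.sum_apply, LinearMap.compl₁₂_apply, LinearMap.coe_comp,
    Function.comp_apply]

omit [NumberField K] in
/-- `R(x, y)` is RATIONAL for rational `x`, `y` (pull-backs and cup products of rational classes are
rational). [cite: Deligne1982HodgeCycles, §4 (4.4)] -/
theorem isRationalClass_pairForm {ι : Type} [Fintype ι] (b e : ι → 𝓞 K) {x : complexBetti (B 0).X 1}
    {y : complexBetti (B 1).X 1} (hx : IsRationalClass x) (hy : IsRationalClass y) :
    IsRationalClass (pairForm B act b e x y) := by
  rw [pairForm_apply]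
  refine Finset.sum_induction _ IsRationalClass (fun _ _ => IsRationalClass.add) IsRationalClass.zero ?_
  intro i _
  exact ((hx.pullback _).pullback _).cup _ ((hy.pullback _).pullback _)

/-- In degree two the monomial is `π_0^* v_{0,σ} ⌣ π_1^* v_{1,σ}`. [folklore] -/
theorem monomial_two (σ : K →+* ℂ) :
    monomial B v σ = cupProduct (Nat.add_comm 1 1) (biprodBasis B v (0, σ)) (biprodBasis B v (1, σ)) := by
  rw [monomial_def, cupPowOne_succ, cupPowOne_one]
  rfl

/-- **`R` on eigenvectors**: `R(v_{0,σ}, v_{1,τ}) = (Σ_i σ(b_i) τ(e_i)) · (π_0^* v_{0,σ} ⌣ π_1^* v_{1,τ})`.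
[cite: Deligne1982HodgeCycles, §4 (4.4)] -/
theorem pairForm_basis (hB : ∀ m, IsCMTypeRealisation (Ψ m) (B m) (act m) (θ m))
    (hv : ∀ m σ, v m σ ∈ eigenline (θ m) σ) {ι : Type} [Fintype ι] (b e : ι → 𝓞 K) (σ τ : K →+* ℂ) :
    pairForm B act b e (v 0 σ) (v 1 τ) = (∑ i, σ (b i : K) * τ (e i : K)) •
      cupProduct (Nat.add_comm 1 1) (biprodBasis B v (0, σ)) (biprodBasis B v (1, τ)) := by
  rw [pairForm_apply, Finset.sum_smul]
  refine Finset.sum_congr rfl fun i _ => ?_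
  rw [map_ι_apply_of_mem_eigenline (hB 0) (hv 0 σ), map_ι_apply_of_mem_eigenline (hB 1) (hv 1 τ)]
  simp only [map_smul, LinearMap.smul_apply, smul_smul, biprodBasis_apply, mul_comm]

/-- **`R` on eigenvectors, dual families**: `R(v_{0,σ}, v_{1,σ}) = N μ_σ` and `R(v_{0,σ}, v_{1,τ}) = 0` for
`σ ≠ τ`. [cite: Deligne1982HodgeCycles, §4 (4.4)] -/
theorem pairForm_basis_self (hB : ∀ m, IsCMTypeRealisation (Ψ m) (B m) (act m) (θ m))
    (hv : ∀ m σ, v m σ ∈ eigenline (θ m) σ) {ι : Type} [Fintype ι] {b e : ι → 𝓞 K} {N : ℤ}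
    (hdiag : ∀ σ : K →+* ℂ, ∑ i, σ (b i : K) * σ (e i : K) = (N : ℂ)) (σ : K →+* ℂ) :
    pairForm B act b e (v 0 σ) (v 1 σ) = (N : ℂ) • monomial B v σ := by
  rw [pairForm_basis hB hv, hdiag, monomial_two]

/-- `R(v_{0,σ}, v_{1,τ}) = 0` for `σ ≠ τ`. [cite: Deligne1982HodgeCycles, §4 (4.4)] -/
theorem pairForm_basis_of_ne (hB : ∀ m, IsCMTypeRealisation (Ψ m) (B m) (act m) (θ m))
    (hv : ∀ m σ, v m σ ∈ eigenline (θ m) σ) {ι : Type} [Fintype ι] {b e : ι → 𝓞 K}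
    (hoff : ∀ σ τ : K →+* ℂ, σ ≠ τ → ∑ i, σ (b i : K) * τ (e i : K) = 0) {σ τ : K →+* ℂ} (h : σ ≠ τ) :
    pairForm B act b e (v 0 σ) (v 1 τ) = 0 := by
  rw [pairForm_basis hB hv, hoff σ τ h, zero_smul]

/-- Every value `R(x, y)` lies in the sum of the monomial lines (bilinearity). [cite: Deligne1982HodgeCycles, §4 (4.4)] -/
theorem pairForm_mem_iSup (hB : ∀ m, IsCMTypeRealisation (Ψ m) (B m) (act m) (θ m))
    (hv : ∀ m σ, v m σ ∈ eigenline (θ m) σ) {ι : Type} [Fintype ι] {b e : ι → 𝓞 K} {N : ℤ}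
    (hdiag : ∀ σ : K →+* ℂ, ∑ i, σ (b i : K) * σ (e i : K) = (N : ℂ))
    (hoff : ∀ σ τ : K →+* ℂ, σ ≠ τ → ∑ i, σ (b i : K) * τ (e i : K) = 0)
    (x : complexBetti (B 0).X 1) (y : complexBetti (B 1).X 1) :
    pairForm B act b e x y ∈ ⨆ σ : K →+* ℂ, ℂ ∙ monomial B v σ := by
  set W : Submodule ℂ (complexBetti (⨁ B).X 2) := ⨆ σ : K →+* ℂ, ℂ ∙ monomial B v σ
  -- first for `x = v 0 σ` and every `y`
  have h1 : ∀ σ y, pairForm B act b e (v 0 σ) y ∈ W := by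
    intro σ
    have hle : (⊤ : Submodule ℂ (complexBetti (B 1).X 1)) ≤ W.comap (pairForm B act b e (v 0 σ)) := by
      rw [← (v 1).span_eq, Submodule.span_le]
      rintro _ ⟨τ, rfl⟩
      rw [SetLike.mem_coe, Submodule.mem_comap]
      by_cases h : σ = τ
      · subst h
        rw [pairForm_basis_self hB hv hdiag]
        exact W.smul_mem _ (Submodule.mem_iSup_of_mem σ (Submodule.mem_span_singleton_self _))
      · rw [pairForm_basis_of_ne hB hv hoff h]
        exact W.zero_mem
    exact fun y => hle Submodule.mem_top
  -- then for every `x`, by linearity in `x`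
  have hle : (⊤ : Submodule ℂ (complexBetti (B 0).X 1)) ≤ W.comap ((pairForm B act b e).flip y) := by
    rw [← (v 0).span_eq, Submodule.span_le]
    rintro _ ⟨σ, rfl⟩
    rw [SetLike.mem_coe, Submodule.mem_comap, LinearMap.flip_apply]
    exact h1 σ y
  have := hle (Submodule.mem_top (x := x))
  rwa [Submodule.mem_comap, LinearMap.flip_apply] at this

omit [NumberField K] in
open scoped Classical in
/-- In a conjugate pair exactly one of the two slots is holomorphic at `σ`. [folklore] -/
theorem card_filter_pair (hΨ : Ψ 1 = CMTypeOps.bar (Ψ 0)) (σ : K →+* ℂ) :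
    (Finset.univ.filter fun j : Fin 2 => σ ∈ (Ψ j).1).card = 1 ∧
      (Finset.univ.filter fun j : Fin 2 => σ ∉ (Ψ j).1).card = 1 := by
  have h1 : σ ∈ (Ψ 1).1 ↔ σ ∉ (Ψ 0).1 := by rw [hΨ]; exact CMTypeOps.mem_bar_iff _ _
  by_cases h0 : σ ∈ (Ψ 0).1
  · have e1 : (Finset.univ.filter fun j : Fin 2 => σ ∈ (Ψ j).1) = {0} := by
      ext j; fin_cases j <;> simp [h0, h1]
    have e2 : (Finset.univ.filter fun j : Fin 2 => σ ∉ (Ψ j).1) = {1} := by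
      ext j; fin_cases j <;> simp [h0, h1]
    rw [e1, e2]; simp
  · have e1 : (Finset.univ.filter fun j : Fin 2 => σ ∈ (Ψ j).1) = {1} := by
      ext j; fin_cases j <;> simp [h0, h1]
    have e2 : (Finset.univ.filter fun j : Fin 2 => σ ∉ (Ψ j).1) = {0} := by
      ext j; fin_cases j <;> simp [h0, h1]
    rw [e1, e2]; simp

/-- **The monomials of a conjugate pair are of type `(1,1)`.** [cite: MoonenZarhin1998WeilClasses, §1] -/
theorem isOfHodgeType_monomial_pair (hB : ∀ m, IsCMTypeRealisation (Ψ m) (B m) (act m) (θ m))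
    (hv : ∀ m σ, v m σ ∈ eigenline (θ m) σ) (hΨ : Ψ 1 = CMTypeOps.bar (Ψ 0)) (σ : K →+* ℂ) :
    IsOfHodgeType (⨁ B).dim (⨁ B).X 2 1 1 (monomial B v σ) := by
  classical
  have h := isOfHodgeType_monomial hB hv (by norm_num : 0 < 2) σ
  rwa [(card_filter_pair hΨ σ).1, (card_filter_pair hΨ σ).2] at h

/-- **Every value `R(x, y)` of the pairing operator of a conjugate pair is of type `(1,1)`.**
[cite: MoonenZarhin1998WeilClasses, §1] -/
theorem isOfHodgeType_pairForm (hB : ∀ m, IsCMTypeRealisation (Ψ m) (B m) (act m) (θ m))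
    (hv : ∀ m σ, v m σ ∈ eigenline (θ m) σ) (hΨ : Ψ 1 = CMTypeOps.bar (Ψ 0)) {ι : Type} [Fintype ι]
    {b e : ι → 𝓞 K} {N : ℤ} (hdiag : ∀ σ : K →+* ℂ, ∑ i, σ (b i : K) * σ (e i : K) = (N : ℂ))
    (hoff : ∀ σ τ : K →+* ℂ, σ ≠ τ → ∑ i, σ (b i : K) * τ (e i : K) = 0)
    (x : complexBetti (B 0).X 1) (y : complexBetti (B 1).X 1) :
    IsOfHodgeType (⨁ B).dim (⨁ B).X 2 1 1 (pairForm B act b e x y) := by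
  have hX : IsSmoothProjective (⨁ B).dim (⨁ B).X := AbelianVariety.isSmoothProjective_holds
  let M : HodgeModel (⨁ B).dim (⨁ B).X := (nonempty_hodgeModel_holds hX).some
  let pq : ↥(Finset.HasAntidiagonal.antidiagonal 2) := ⟨(1, 1), by simp⟩
  have hle : (⨆ σ : K →+* ℂ, ℂ ∙ monomial B v σ) ≤ M.typePiece 2 pq := by
    refine iSup_le fun σ => (Submodule.span_singleton_le_iff_mem _ _).2 ?_
    exact (HodgeModel.mem_typePiece_iff_isOfHodgeType hX M pq _).2 (isOfHodgeType_monomial_pair hB hv hΨ σ)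
  exact (HodgeModel.mem_typePiece_iff_isOfHodgeType hX M pq _).1 (hle (pairForm_mem_iSup hB hv hdiag hoff x y))

/-- **Every value `R(x, y)` is ALGEBRAIC** — for rational `x`, `y` by the Lefschetz theorem on `(1,1)`-classes
(`lefschetzOneOne_rational_holds`), in general because rational classes span `H¹` over `ℂ` and `R` is
bilinear. [cite: VoisinHodgeI2002, Thm. 11.30] -/
theorem pairForm_mem_algebraicClasses (hB : ∀ m, IsCMTypeRealisation (Ψ m) (B m) (act m) (θ m))
    (hv : ∀ m σ, v m σ ∈ eigenline (θ m) σ) (hΨ : Ψ 1 = CMTypeOps.bar (Ψ 0)) {ι : Type} [Fintype ι]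
    {b e : ι → 𝓞 K} {N : ℤ} (hdiag : ∀ σ : K →+* ℂ, ∑ i, σ (b i : K) * σ (e i : K) = (N : ℂ))
    (hoff : ∀ σ τ : K →+* ℂ, σ ≠ τ → ∑ i, σ (b i : K) * τ (e i : K) = 0)
    (x : complexBetti (B 0).X 1) (y : complexBetti (B 1).X 1) :
    pairForm B act b e x y ∈ algebraicClasses (⨁ B).X 1 := by
  have hX : IsSmoothProjective (⨁ B).dim (⨁ B).X := AbelianVariety.isSmoothProjective_holds
  have h0 : IsSmoothProjective (B 0).dim (B 0).X := AbelianVariety.isSmoothProjective_holds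
  have h1 : IsSmoothProjective (B 1).dim (B 1).X := AbelianVariety.isSmoothProjective_holds
  set N₁ : Submodule ℂ (complexBetti (⨁ B).X 2) := algebraicClasses (⨁ B).X 1
  -- rational arguments
  have hrat : ∀ {x : complexBetti (B 0).X 1} {y : complexBetti (B 1).X 1}, IsRationalClass x →
      IsRationalClass y → pairForm B act b e x y ∈ N₁ :=
    fun hx hy => lefschetzOneOne_rational_holds hX _ (isRationalClass_pairForm b e hx hy)
      (isOfHodgeType_pairForm hB hv hΨ hdiag hoff _ _)
  -- rational bases span `H¹`
  obtain ⟨r₀, c₀, hc₀⟩ := exists_basis_isRationalClass h0 1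
  obtain ⟨r₁, c₁, hc₁⟩ := exists_basis_isRationalClass h1 1
  have hxfix : ∀ i, ∀ y, pairForm B act b e (c₀ i) y ∈ N₁ := by
    intro i
    have hle : (⊤ : Submodule ℂ (complexBetti (B 1).X 1)) ≤ N₁.comap (pairForm B act b e (c₀ i)) := by
      rw [← c₁.span_eq, Submodule.span_le]
      rintro _ ⟨i', rfl⟩
      rw [SetLike.mem_coe, Submodule.mem_comap]
      exact hrat (hc₀ i) (hc₁ i')
    exact fun y => hle Submodule.mem_top
  have hle : (⊤ : Submodule ℂ (complexBetti (B 0).X 1)) ≤ N₁.comap ((pairForm B act b e).flip y) := by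
    rw [← c₀.span_eq, Submodule.span_le]
    rintro _ ⟨i, rfl⟩
    rw [SetLike.mem_coe, Submodule.mem_comap, LinearMap.flip_apply]
    exact hxfix i y
  have := hle (Submodule.mem_top (x := x))
  rwa [Submodule.mem_comap, LinearMap.flip_apply] at this

/-- **The monomials of a conjugate pair are algebraic**: `μ_σ = N⁻¹ R(v_{0,σ}, v_{1,σ})` for an integral dual
family `(b, e, N)` (`exists_integral_dual_family`). [cite: Deligne1982HodgeCycles, §4 (4.4)]
[cite: VoisinHodgeI2002, Thm. 11.30] -/
theorem pairMonomial_mem_algebraicClasses (hB : ∀ m, IsCMTypeRealisation (Ψ m) (B m) (act m) (θ m))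
    (hv : ∀ m σ, v m σ ∈ eigenline (θ m) σ) (hΨ : Ψ 1 = CMTypeOps.bar (Ψ 0)) (σ : K →+* ℂ) :
    monomial B v σ ∈ algebraicClasses (⨁ B).X 1 := by
  obtain ⟨ι, _, b, e, N, hN, hdiag, hoff⟩ := exists_integral_dual_family K
  have h := pairForm_mem_algebraicClasses hB hv hΨ hdiag hoff (v 0 σ) (v 1 σ)
  rw [pairForm_basis_self hB hv hdiag] at h
  have hN' : (N : ℂ) ≠ 0 := Int.cast_ne_zero.2 hN
  have := (algebraicClasses (⨁ B).X 1).smul_mem (N : ℂ)⁻¹ h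
  rwa [smul_smul, inv_mul_cancel₀ hN', one_smul] at this

end Pair

end Summit.HodgeConjecture.CorCM.WeilLineMonomial

end
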